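import Summits.BirchSwinnertonDyer.BirchSwinnertonDyer.Theorems.InertBadSignedBranchesInertBadAtThreeQuarticCleanAssemblyEven
import Summits.BirchSwinnertonDyer.BirchSwinnertonDyer.Theorems.InertBadSignedBranchesInertBadAtThreeQuarticModelKRange
import Summits.BirchSwinnertonDyer.BirchSwinnertonDyer.Theorems.InertBadSignedBranchesInertBadAtThreeQuarticModelUnit
import Summits.BirchSwinnertonDyer.BirchSwinnertonDyer.Theorems.InertBadSignedBranchesInertBadAtThreeQuarticValueExit
import HarnessLib

/-!
# C⁺_quartic (the v4 statement `NeronIntegralThreeQuartic`: F-es-18's body on the whole quartic cell, BOTH parities, every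
# modulus prime to `3`) modulo the theta dictionary — the two-parity `V`-level glue

Summit `BirchSwinnertonDyer`, crux `InertBadAtThree` (stmt-BirchSwinnertonDyer-19225), line of record
`Cruxes/InertBadAtThree/Lines/rubin_e1_inert_three.lean` v5 (lead `bsd-line-ibd-p1` g7; `--supports 19225`, helper). The v5 registered stub
needs only the odd branch at prime moduli (closer of record: bed-w3 g8's `…QuarticStubOfDictionary.plainOddNeronIntegralThreeQuartic_of_dictionary`,
p631807). This file gives the STRONGER v4 statement of the line (`Lines/rubin_e1_inert_three.lean` ll. 152–187: `NeronIntegralThreeQuartic`,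
= the named Literature statement F-es-18 `kato_neron_isIntegral_twistedSymbolSum_of_additive_three_polar` restricted to globally minimal `V`
with `j = 1728` bad at `3`) modulo the SAME kind of hypothesis — the theta dictionary (STUB-PLAN P1b) for the quartic models
`y² = x³ + Ax`, now for every modulus `m` with `3 ∤ m` and every primitive `χ`:

* ★ `neronIntegralThreeQuartic_of_dictionary` — chain: fourth-power-free model `C • V = ⟨0,0,0,A,0⟩` with `v₃(u_C) = 0`
  (bed-w3 g8 `…QuarticModelUnit.exists_smul_eq_quartic_fourthPowerFree`, `…QuarticModelKRange.padicValInt_le_three_of_smul_eq_quartic`)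
  → the model-level even/odd statements (`evenLValue_quartic_of_dictionary` / `oddLValue_quartic_of_dictionary`, P6 parts B/C) → transport
  to `V` (`…QuarticModel.LValueEven_of_smul` / `LValueOdd_of_smul`) → the stub body (`…QuarticValueExit.neronIntegralThreePolarAt_of_LValues`).

Consumers: crux 22968's `kato_shift_three` debt on the quartic cell; K8 child 19657 (via `maninAtThree_of_printedInputs_of_quarticFact` of the
Lines file). HONEST FRAMING: conditional on the dictionary hypothesis; nothing here proves F-es-18, the stub, the crux or BSD. No definitions,
no named facts, no `sorry`; axioms standard.
-/

set_option linter.dupNamespace false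
set_option autoImplicit false

noncomputable section

open scoped ComplexConjugate
open Complex
open Literature.NumberTheory.EllipticCurves Literature.NumberTheory.EllipticCurves.ModularForms
open Literature.NumberTheory.LFunctions Literature.NumberTheory.LFunctions.GaussianTheta

namespace Summit.BirchSwinnertonDyer.BirchSwinnertonDyer.Theorems.InertBadSignedBranchesInertBadAtThreeQuarticCleanAssembly

variable {q : GaussianInt → ℂ}
  (hq : ∀ x : GaussianInt, q x =
    if (3 : ℤ) ∣ x.re ∧ (3 : ℤ) ∣ x.im then 0
    else if (3 : ℤ) ∣ x.im then 1
    else if (3 : ℤ) ∣ x.re then -1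
    else if (3 : ℤ) ∣ x.re - x.im then -I
    else I)

include hq

/-- ★ **C⁺_quartic (v4 `NeronIntegralThreeQuartic`, F-es-18's body on the quartic cell, both parities) from the theta dictionary for the
models `y² = x³ + Ax` (`A ≠ 0` fourth-power-free, `3 ∣ A`; every `m` with `3 ∤ m`, every primitive `χ` mod `m`).**
[cite: Kato2004Asterisque, (8.1.3) (p. 180), Thm. 6.6 (1) (p. 163)] [cite: Rubin1999, Prop. 7.15] [cite: MazurTateTeitelbaum1986, §I.8 (8.6)] -/
theorem neronIntegralThreeQuartic_of_dictionary
    (hdict : ∀ (A : ℤ), A ≠ 0 → (3 : ℤ) ∣ A → (∀ p : ℕ, p.Prime → ¬ ((p : ℤ) ^ 4 ∣ A)) →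
      ∀ (m : ℕ) [NeZero m], ¬ 3 ∣ m → ∀ χ : DirichletCharacter ℂ m, χ.IsPrimitive →
      ∃ (M' : ℕ) (_ : NeZero M') (_ : NeZero (3 * M')) (Ψ : GaussianInt → ℂ), Nat.Coprime 3 M' ∧
        (∀ x y : GaussianInt, Ψ (x + M' * y) = Ψ x) ∧ (∀ x : GaussianInt, IsIntegral ℤ (Ψ x)) ∧
        ∀ s : ℂ, 2 < s.re →
          LSeries (fun n : ℕ ↦ χ⁻¹ (n : ZMod m) * ((⟨0, 0, 0, (A : ℚ), 0⟩ : WeierstrassCurve ℚ).LFunction n : ℂ)) s =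
            (1 / 4 : ℂ) * thetaLFunction (3 * M') (fun x ↦ (conj (q x)) ^ (padicValInt 3 A) * Ψ x) s) :
    ∀ (V : WeierstrassCurve ℚ) [V.IsElliptic] [V.IsGloballyMinimal],
      V.j = 1728 → ¬ V.HasGoodReductionAtPrime 3 →
      ∀ {N : ℕ} [NeZero N]
        (f : CuspForm (CongruenceSubgroup.Gamma0 N) 2)
        (_ : Literature.NumberTheory.EllipticCurves.ModularForms.IsNewformOf V f)
        (_ : ¬ V.HasGoodReductionAtPrime 3) (_ : ¬ V.HasMultiplicativeReductionAtPrime 3)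
        (_ : V.HasIrreducibleModPGaloisRep 3) (m : ℕ) [NeZero m] (_ : m.Coprime (3 * N))
        (χ : DirichletCharacter ℂ m) (_ : χ.IsPrimitive) (_ : χ ≠ 1) (_ : ¬ 3 ∣ orderOf χ)
        (_ : χ (3 : ZMod m) ≠ 1) (_ : χ (3 : ZMod m) ≠ -1) (ϖ : ℚ) (r : ℂ),
        (χ.Even → (ϖ : ℝ) * V.realPeriodRat = Literature.NumberTheory.EllipticCurves.ModularForms.plusPeriod f →
          (∏ ℓ ∈ N.primeFactors with ¬ ℓ ^ 2 ∣ N,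
              (((ℓ : ℂ) - (V.LFunction ℓ : ℂ) * χ (ℓ : ZMod m)) *
                ((ℓ : ℂ) - (V.LFunction ℓ : ℂ) * (χ (ℓ : ZMod m))⁻¹))) *
              Literature.NumberTheory.EllipticCurves.ModularForms.twistedSymbolSum f χ =
            r * (Literature.NumberTheory.EllipticCurves.ModularForms.plusPeriod f : ℂ) →
          ∃ s : ℕ, ¬ 3 ∣ s ∧ IsIntegral ℤ ((s : ℂ) * ϖ * r)) ∧
        (χ.Odd → (ϖ : ℝ) * V.imaginaryPeriodRat = Literature.NumberTheory.EllipticCurves.ModularForms.minusPeriod f →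
          (∏ ℓ ∈ N.primeFactors with ¬ ℓ ^ 2 ∣ N,
              (((ℓ : ℂ) - (V.LFunction ℓ : ℂ) * χ (ℓ : ZMod m)) *
                ((ℓ : ℂ) - (V.LFunction ℓ : ℂ) * (χ (ℓ : ZMod m))⁻¹))) *
              Literature.NumberTheory.EllipticCurves.ModularForms.twistedSymbolSum f χ =
            r * (Literature.NumberTheory.EllipticCurves.ModularForms.minusPeriod f : ℂ) * Complex.I →
          ∃ s : ℕ, ¬ 3 ∣ s ∧ IsIntegral ℤ ((s : ℂ) * ϖ * r)) := by
  intro V _ _ hj hbad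
  haveI : Fact (Nat.Prime 3) := ⟨Nat.prime_three⟩
  obtain ⟨A, C, hCV, hA0, h3A, h4, hu⟩ :=
    InertBadSignedBranchesInertBadAtThreeQuarticModelUnit.exists_smul_eq_quartic_fourthPowerFree V hj hbad
  have hk3 : padicValInt 3 A ≤ 3 :=
    InertBadSignedBranchesInertBadAtThreeQuarticModelKRange.padicValInt_le_three_of_smul_eq_quartic V hCV hu
  have hk1 : 1 ≤ padicValInt 3 A := by
    rcases (padicValInt_dvd_iff (p := 3) 1 A).mp (by simpa using h3A) with h | h
    · exact absurd h hA0
    · exact h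
  have hkA : 3 ^ padicValInt 3 A ∣ A.natAbs := pow_padicValNat_dvd
  have hden : ¬ 3 ∣ ((C.u : ℚ)).den := KramerTwoDescent.not_dvd_den_of_padicValRat_eq_zero hu
  have hEven : ∀ (m : ℕ) [NeZero m], ¬ 3 ∣ m → ∀ χ : DirichletCharacter ℂ m, χ.IsPrimitive → χ ≠ 1 → ¬ 3 ∣ orderOf χ →
      χ (3 : ZMod m) ≠ 1 → χ (3 : ZMod m) ≠ -1 → χ.Even →
      ∃ L : ℂ → ℂ, Differentiable ℂ L ∧
        (∀ s : ℂ, 2 < s.re → L s = LSeries (fun n : ℕ ↦ χ⁻¹ (n : ZMod m) * (V.LFunction n : ℂ)) s) ∧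
        ∃ s : ℕ, ¬ 3 ∣ s ∧ IsIntegral ℤ ((s : ℂ) *
          (gaussSum χ (ZMod.stdAddChar (N := m)) * L 1 / (V.realPeriodRat : ℂ))) := by
    intro m _ h3m χ hχ _ _ _ _ _
    refine InertBadSignedBranchesInertBadAtThreeQuarticModel.LValueEven_of_smul (p := 3) V C hden χ ?_
    rw [hCV]
    obtain ⟨M', _, _, Ψ, h3, hΨ, hΨint, hL⟩ := hdict A hA0 h3A h4 m h3m χ hχ
    exact evenLValue_quartic_of_dictionary hq A hA0 hk1 hk3 hkA χ h3 Ψ hΨ hΨint hL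
  have hOdd : ∀ (m : ℕ) [NeZero m], ¬ 3 ∣ m → ∀ χ : DirichletCharacter ℂ m, χ.IsPrimitive → χ ≠ 1 → ¬ 3 ∣ orderOf χ →
      χ (3 : ZMod m) ≠ 1 → χ (3 : ZMod m) ≠ -1 → χ.Odd →
      ∃ L : ℂ → ℂ, Differentiable ℂ L ∧
        (∀ s : ℂ, 2 < s.re → L s = LSeries (fun n : ℕ ↦ χ⁻¹ (n : ZMod m) * (V.LFunction n : ℂ)) s) ∧
        ∃ s : ℕ, ¬ 3 ∣ s ∧ IsIntegral ℤ ((s : ℂ) *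
          (gaussSum χ (ZMod.stdAddChar (N := m)) * L 1 / (Complex.I * (V.imaginaryPeriodRat : ℂ)))) := by
    intro m _ h3m χ hχ _ _ _ _ _
    refine InertBadSignedBranchesInertBadAtThreeQuarticModel.LValueOdd_of_smul (p := 3) V C hden χ ?_
    rw [hCV]
    obtain ⟨M', _, _, Ψ, h3, hΨ, hΨint, hL⟩ := hdict A hA0 h3A h4 m h3m χ hχ
    exact oddLValue_quartic_of_dictionary hq A hA0 hk1 hk3 hkA χ h3 Ψ hΨ hΨint hL
  intro N _ f hf hg hm hi m _ hcop χ hχ h1 ho h3 h3' ϖ r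
  exact InertBadSignedBranchesInertBadAtThreeQuarticValueExit.neronIntegralThreePolarAt_of_LValues V hEven hOdd
    f hf hg hm hi m hcop χ hχ h1 ho h3 h3' ϖ r

end Summit.BirchSwinnertonDyer.BirchSwinnertonDyer.Theorems.InertBadSignedBranchesInertBadAtThreeQuarticCleanAssembly

end
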